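import Summits.QuantumFields.YangMills.Theorems.BalabanLadderUVSeamRecCeilingsResponseMoments
import Summits.QuantumFields.YangMills.Theorems.BalabanLadderUVSeamRecCeilingsPolymerRarityMoments
import HarnessLib

/-!
# Crux `UVSeamRec` (stmt-QuantumFields-20043), stub `stub_ceilings` (E0′): CARRIERS for the response moments (RM) —
# a pointwise split of the rescaled response into finitely many carriers, each with K-fold joint exponential
# moments, gives (RM); the large-field carrier is supplied by a polymer PRODUCT LAW

Helper file (`--supports stmt-QuantumFields-20043`) of the width-lever seat `ym-20043-ceilings-p2` (lane B, gen 2);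
sequel of p532025 `…CeilingsResponseMoments.lean` (`momentBounds6_of_responseMoments : (RM) → MomentBounds6 G r a`) and
of p527372 `…CeilingsPolymerRarity.lean` (polymer-gas domination `integral_exp_mul_sum_influence_le`).  HONEST FRAMING:
consumption-side composition theorems for the OPEN hypothesis (RM) of the v5(α) architecture (owner ruling R86g/R86j:
ONE non-fed stub `UV → (RM)`); the discharge architecture (β) «quadratic carrier + large-field correction» is typed here
ABSTRACTLY in its carriers; nothing of E0′ is claimed; not a gap, not Clay.

WHAT.  (RM) asks, on every odd torus and every cyclically separated family of radius-`R+1` cubes, for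
`⟨exp(Σ_{i∈T} (R⁴/C₁)|kerE_i(plane_i)(lift ·) − p_i|)⟩ ≤ e^{B·#T}` with a β-UNIFORM `B`.  The documented way to prove
it (owner R86g (2)) is a background-field split of the cube response, for EVERY exterior `η`,

  (split)  `(R⁴/C₁)|kerE_i(η) − p_i| ≤ A₀ + Σ_{k<K} Y⁽ᵏ⁾_i(η)`

into finitely many nonnegative-or-not CARRIERS (K = 2: `Y⁽⁰⁾ = βR⁴|F_harm|²` the quadratic harmonic-extension carrier,
`Y⁽¹⁾ = LF` the multiscale large-field correction), followed by SEPARATE measure-side bounds for each carrier.  The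
composition costs nothing in the exponent budget: by convexity of `exp` (AM–GM),
`exp(Σ_k Y⁽ᵏ⁾) ≤ (1/K) Σ_k exp(K·Y⁽ᵏ⁾)`, so K-FOLD joint exponential moments `⟨exp(K·Σ_{i∈T} Y⁽ᵏ⁾_i∘lift)⟩ ≤ e^{B_k·#T}`
of each carrier ALONE give (RM) with `B = A₀ + max_k B_k` — no Hölder, no product of moments, no independence.

* §0 `exp_sum_le_avg_exp_mul`, `integral_exp_sum_le_avg`, `integral_exp_sum_le_exp_of_forall` — the AM–GM step on any
  measure space.
* §1 **`responseMoments_of_carriers`** — (split) for all exteriors + K-fold joint exponential moments of each carrier on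
  every odd torus ⇒ (RM) VERBATIM (the hypothesis `hRM` of p532025 `momentBounds6_of_responseMoments`) with
  `B = A₀ + B'`; **`momentBounds6_of_carriers`** — hence `MomentBounds6 G r a` with `C = C₁(2 + e^{A₀+B'})e^{A₀+B'}`.
* §2 **`responseMoments_of_quadratic_and_polymerLaw`** — the two-carrier instance of record: an abstract «quadratic»
  carrier `Q` with DOUBLED joint exponential moments `⟨exp(2 Σ_{i∈T} Q_i∘lift)⟩ ≤ e^{B_Q·#T}`, and a large-field carrier
  dominated on the torus by a LINEAR functional `Σ_γ c_{iγ} 1_{E_γ}` of polymer events obeying the Peierls PRODUCT LAW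
  `⟨∏_{γ∈A} 1_{E_γ}∘lift⟩ ≤ ∏_{γ∈A} w_γ` with β-uniform budgets `Σ_i c_{iγ} ≤ Λ`, `Σ_γ c_{iγ} w_γ ≤ W` (p528131's (PL)
  typing, budgets constant) ⇒ (RM) with `B = A₀ + max(B_Q, 2e^{2Λ}W)`; `momentBounds6_of_quadratic_and_polymerLaw`.
  The large-field half is CLOSED at the plaquette scale on every odd torus by p530009 `productLaw_largePlaquettes`;
  the Λ-budget for the canonical multiscale coefficients `(b^k/dist)⁴` is tempered-d1's `sum_familyCoeff_le_one`.

References: folklore (finite Jensen / AM–GM for `exp`); H.-O. Georgii, *Gibbs Measures and Phase Transitions* (2011)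
Thm. 4.17 (DLR part, via p530862); the intended suppliers are T. Bałaban, Commun. Math. Phys. 122 (1989) 355–392
(large-field regions, (1.79)–(1.89)) for the large-field carrier and a background-field expansion of the cube kernel for
the quadratic carrier.
-/

set_option autoImplicit false

noncomputable section

open MeasureTheory Filter Topology Finset
open Literature.Probability.LatticeModels
open Literature.MathematicalPhysics.QuantumFieldTheory (GaugeConfig wilsonMeasure isProbabilityMeasure_wilsonMeasure
  measurable_torusLift LatticeRep)
open Literature.MathematicalPhysics.QuantumLattice

namespace Summit.QuantumFields.YangMills.Cruxes.UVSeamRec.TemperedResponse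

/-! ## §0 The AM–GM step: exponential of a sum of `K` carriers versus the `K`-fold exponentials -/

section Generic

variable {Ω : Type*} [MeasurableSpace Ω] (μ : Measure Ω)

/-- **AM–GM for exponentials of a finite sum.**  `exp(Σ_{k<K} f_k) ≤ (1/K)·Σ_{k<K} exp(K·f_k)` (`K ≥ 1`): finite Jensen for
the convex function `exp` with equal weights `1/K` at the points `K·f_k`. [folklore] -/
theorem exp_sum_le_avg_exp_mul {K : ℕ} (hK : 0 < K) (f : Fin K → ℝ) :
    Real.exp (∑ k, f k) ≤ (1 / (K : ℝ)) * ∑ k, Real.exp ((K : ℝ) * f k) := by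
  have hK0 : (K : ℝ) ≠ 0 := by exact_mod_cast hK.ne'
  have h := (convexOn_exp).map_sum_le (t := (Finset.univ : Finset (Fin K))) (w := fun _ => 1 / (K : ℝ))
    (p := fun k => (K : ℝ) * f k) (fun _ _ => by positivity) ?_ (fun _ _ => Set.mem_univ _)
  · have hsum : ∑ k : Fin K, (1 / (K : ℝ)) • ((K : ℝ) * f k) = ∑ k, f k := by
      refine Finset.sum_congr rfl fun k _ => ?_
      rw [smul_eq_mul]; field_simp
    rw [hsum] at h
    refine h.trans (le_of_eq ?_)
    rw [Finset.mul_sum]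
    refine Finset.sum_congr rfl fun k _ => ?_
    rw [smul_eq_mul]
  · rw [Finset.sum_const, Finset.card_univ, Fintype.card_fin, nsmul_eq_mul]
    field_simp

/-- **Integrated AM–GM.**  If the `K`-fold exponentials `exp(K·f_k)` are integrable, then
`∫ exp(Σ_k f_k) dμ ≤ (1/K) Σ_k ∫ exp(K·f_k) dμ`. [folklore] -/
theorem integral_exp_sum_le_avg {K : ℕ} (hK : 0 < K) (f : Fin K → Ω → ℝ)
    (hint : ∀ k, Integrable (fun ω => Real.exp ((K : ℝ) * f k ω)) μ) :
    ∫ ω, Real.exp (∑ k, f k ω) ∂μ ≤ (1 / (K : ℝ)) * ∑ k, ∫ ω, Real.exp ((K : ℝ) * f k ω) ∂μ := by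
  rw [← integral_finsetSum _ fun k _ => hint k, ← integral_const_mul]
  refine integral_mono_of_nonneg (ae_of_all _ fun ω => (Real.exp_pos _).le)
    ((integrable_finsetSum _ fun k _ => hint k).const_mul _) (ae_of_all _ fun ω => ?_)
  exact exp_sum_le_avg_exp_mul hK fun k => f k ω

/-- **Uniform version.**  If moreover `∫ exp(K·f_k) dμ ≤ M` for every `k`, then `∫ exp(Σ_k f_k) dμ ≤ M`. [folklore] -/
theorem integral_exp_sum_le_of_forall {K : ℕ} (hK : 0 < K) (f : Fin K → Ω → ℝ)
    (hint : ∀ k, Integrable (fun ω => Real.exp ((K : ℝ) * f k ω)) μ) {M : ℝ}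
    (hM : ∀ k, ∫ ω, Real.exp ((K : ℝ) * f k ω) ∂μ ≤ M) :
    ∫ ω, Real.exp (∑ k, f k ω) ∂μ ≤ M := by
  have hK0 : (0 : ℝ) < K := by exact_mod_cast hK
  refine (integral_exp_sum_le_avg μ hK f hint).trans ?_
  calc (1 / (K : ℝ)) * ∑ k : Fin K, ∫ ω, Real.exp ((K : ℝ) * f k ω) ∂μ
      ≤ (1 / (K : ℝ)) * ∑ _k : Fin K, M := by
        refine mul_le_mul_of_nonneg_left (Finset.sum_le_sum fun k _ => hM k) (by positivity)
    _ = M := by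
        rw [Finset.sum_const, Finset.card_univ, Fintype.card_fin, nsmul_eq_mul]
        field_simp

end Generic

/-! ## §1 (RM) from a carrier split and K-fold joint exponential moments of the carriers -/

section Route

open Summit.QuantumFields.YangMills.Cruxes.OSLegsFromFemtoAndGap.DlrCollarTransfer
open Summit.QuantumFields.YangMills.Cruxes.UV.TorusClass

variable {G : Type} [Group G] [TopologicalSpace G] [IsTopologicalGroup G] [CompactSpace G]
  [MeasurableSpace G] [BorelSpace G] (r : LatticeRep G) (a : ℝ → ℝ)

/-- **(RM) from CARRIERS.**  Data: `K ≥ 1` measurable carriers `Y k β R q x : LGConfig 4 G → ℝ` of the exterior of the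
radius-`R+1` cube around `x` (orientation `q`), each bounded in absolute value by `MY β R`; constants `C₁ > 0`, `A₀`,
`B'`, `β₁`, `ℓ₁`; reference values `p q β`.  Hypotheses: (split) for `β ≥ β₁`, `1 ≤ R`, `R·a β ≤ ℓ₁`, `q.1 < q.2` and EVERY
exterior `η`, `(R⁴/C₁)|kerE_{x−(R+1),2R+3}(plane q x)(η) − p q β| ≤ A₀ + Σ_k Y k β R q x η`; (EM_K) for every carrier
`k`, on every odd torus `(ℤ/(2L+1))⁴` with `4R+8 ≤ L` and every cyclically `2R+4`-separated family and index set `T`,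
`⟨exp(K·Σ_{i∈T} Y k β R (q i) (x i)∘lift)⟩_{2L+1,β} ≤ exp(B'·#T)`.  THEN (RM) holds VERBATIM (hypothesis `hRM` of
p532025 `momentBounds6_of_responseMoments`) with `B = A₀ + B'`.  Proof: pointwise split, then AM–GM
`exp(Σ_k Z_k) ≤ (1/K)Σ_k exp(K Z_k)` with `Z_k = Σ_{i∈T} Y k … ∘lift`, integrate, average the K bounds.  No Hölder, no
independence of the carriers, no rate. [folklore] -/
theorem responseMoments_of_carriers {K : ℕ} (hK : 0 < K) {C₁ β₁ ℓ₁ A₀ B' : ℝ} {p : Fin 4 × Fin 4 → ℝ → ℝ}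
    (Y : Fin K → ℝ → ℕ → Fin 4 × Fin 4 → (Fin 4 → ℤ) → LGConfig 4 G → ℝ) (MY : ℝ → ℕ → ℝ)
    (hYm : ∀ k β R q x, Measurable (Y k β R q x)) (hYb : ∀ k β R q x η, |Y k β R q x η| ≤ MY β R)
    (hsplit : ∀ β : ℝ, β₁ ≤ β → ∀ R : ℕ, 1 ≤ R → (R : ℝ) * a β ≤ ℓ₁ →
      ∀ (q : Fin 4 × Fin 4) (x : Fin 4 → ℤ), q.1 < q.2 → ∀ η : LGConfig 4 G,
        (R : ℝ) ^ 4 / C₁ * |kerE G r β (fun k => x k - (R + 1)) (2 * R + 3) η (plane G r q x) - p q β| ≤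
          A₀ + ∑ k, Y k β R q x η)
    (hEM : ∀ k : Fin K, ∀ β : ℝ, β₁ ≤ β → ∀ (L n : ℕ) (q : Fin n → Fin 4 × Fin 4) (x : Fin n → (Fin 4 → ℤ)) (R : ℕ),
      (∀ i, (q i).1 < (q i).2) → 1 ≤ R → (R : ℝ) * a β ≤ ℓ₁ → 4 * R + 8 ≤ L →
      (∀ i j : Fin n, i ≠ j → ∃ k : Fin 4,
        (2 * (R : ℤ) + 4) ≤ |((((x i k - x j k : ℤ) : ZMod (2 * L + 1))).valMinAbs : ℤ)|) →
      ∀ T : Finset (Fin n),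
        torusE G r β L (fun U => Real.exp ((K : ℝ) * ∑ i ∈ T, Y k β R (q i) (x i) U)) ≤ Real.exp (B' * T.card)) :
    ∀ β : ℝ, β₁ ≤ β → ∀ (L n : ℕ) (q : Fin n → Fin 4 × Fin 4) (x : Fin n → (Fin 4 → ℤ)) (R : ℕ),
      (∀ i, (q i).1 < (q i).2) → 1 ≤ R → (R : ℝ) * a β ≤ ℓ₁ → 4 * R + 8 ≤ L →
      (∀ i j : Fin n, i ≠ j → ∃ k : Fin 4,
        (2 * (R : ℤ) + 4) ≤ |((((x i k - x j k : ℤ) : ZMod (2 * L + 1))).valMinAbs : ℤ)|) →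
      ∀ T : Finset (Fin n),
        torusE G r β L (fun U => Real.exp (∑ i ∈ T, (R : ℝ) ^ 4 / C₁ *
          |kerE G r β (fun k => x i k - (R + 1)) (2 * R + 3) U (plane G r (q i) (x i)) - p (q i) β|)) ≤
          Real.exp ((A₀ + B') * T.card) := by
  intro β hβ L n q x R hq hR hRa hRL hsep T
  haveI := isProbabilityMeasure_wilsonMeasure (d := 4) (L := 2 * L + 1) r.ρ r.continuous β
  -- the carriers read on the torus
  set Z : Fin K → GaugeConfig 4 (2 * L + 1) G → ℝ :=
    fun k U => ∑ i ∈ T, Y k β R (q i) (x i) (torusLift (2 * L + 1) U) with hZdef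
  have hZm : ∀ k, Measurable (Z k) := fun k =>
    Finset.measurable_sum T fun i _ => (hYm k β R (q i) (x i)).comp (measurable_torusLift _)
  have hMY : 0 ≤ MY β R := by
    obtain ⟨k₀⟩ : Nonempty (Fin K) := ⟨⟨0, hK⟩⟩
    exact (abs_nonneg _).trans (hYb k₀ β R (0, 1) 0 (fun _ => 1))
  have hZb : ∀ k U, |Z k U| ≤ T.card * MY β R := fun k U => by
    rw [hZdef]
    refine (Finset.abs_sum_le_sum_abs _ _).trans ?_
    calc ∑ i ∈ T, |Y k β R (q i) (x i) (torusLift (2 * L + 1) U)| ≤ ∑ _i ∈ T, MY β R :=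
          Finset.sum_le_sum fun i _ => hYb k β R (q i) (x i) _
      _ = T.card * MY β R := by rw [Finset.sum_const, nsmul_eq_mul]
  -- integrability of the K-fold exponentials (bounded measurable on a probability space)
  have hint : ∀ k, Integrable (fun U => Real.exp ((K : ℝ) * Z k U))
      (wilsonMeasure (d := 4) (L := 2 * L + 1) r.ρ β) := fun k => by
    refine integrable_of_abs_le ((hZm k).const_mul _).exp (C := Real.exp ((K : ℝ) * (T.card * MY β R)))
      fun U => ?_
    rw [Real.abs_exp]
    refine Real.exp_le_exp.2 (mul_le_mul_of_nonneg_left ((le_abs_self _).trans (hZb k U)) (by positivity))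
  -- the K-fold moment bounds
  have hM : ∀ k, ∫ U, Real.exp ((K : ℝ) * Z k U) ∂(wilsonMeasure (d := 4) (L := 2 * L + 1) r.ρ β) ≤
      Real.exp (B' * T.card) := fun k => by
    have h := hEM k β hβ L n q x R hq hR hRa hRL hsep T
    simpa only [torusE, hZdef] using h
  -- AM–GM
  have havg := integral_exp_sum_le_of_forall (wilsonMeasure (d := 4) (L := 2 * L + 1) r.ρ β) hK Z hint hM
  -- pointwise split, summed over `T`
  have hsplit' : ∀ U : GaugeConfig 4 (2 * L + 1) G,
      Real.exp (∑ i ∈ T, (R : ℝ) ^ 4 / C₁ *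
        |kerE G r β (fun k => x i k - (R + 1)) (2 * R + 3) (torusLift (2 * L + 1) U) (plane G r (q i) (x i)) -
          p (q i) β|) ≤ Real.exp (A₀ * T.card) * Real.exp (∑ k, Z k U) := fun U => by
    rw [← Real.exp_add]
    refine Real.exp_le_exp.2 ?_
    calc ∑ i ∈ T, (R : ℝ) ^ 4 / C₁ *
          |kerE G r β (fun k => x i k - (R + 1)) (2 * R + 3) (torusLift (2 * L + 1) U) (plane G r (q i) (x i)) -
            p (q i) β|
        ≤ ∑ i ∈ T, (A₀ + ∑ k, Y k β R (q i) (x i) (torusLift (2 * L + 1) U)) :=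
          Finset.sum_le_sum fun i _ => hsplit β hβ R hR hRa (q i) (x i) (hq i) _
      _ = A₀ * T.card + ∑ k, Z k U := by
          rw [Finset.sum_add_distrib, Finset.sum_const, nsmul_eq_mul, Finset.sum_comm]
          ring
  -- integrate
  have hintR : Integrable (fun U => Real.exp (A₀ * T.card) * Real.exp (∑ k, Z k U))
      (wilsonMeasure (d := 4) (L := 2 * L + 1) r.ρ β) := by
    refine (integrable_of_abs_le (Finset.measurable_sum _ fun k _ => hZm k).exp
      (C := Real.exp (∑ _k : Fin K, (T.card * MY β R))) fun U => ?_).const_mul _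
    rw [Real.abs_exp]
    exact Real.exp_le_exp.2 (Finset.sum_le_sum fun k _ => (le_abs_self _).trans (hZb k U))
  calc torusE G r β L (fun U => Real.exp (∑ i ∈ T, (R : ℝ) ^ 4 / C₁ *
          |kerE G r β (fun k => x i k - (R + 1)) (2 * R + 3) U (plane G r (q i) (x i)) - p (q i) β|))
      ≤ ∫ U, Real.exp (A₀ * T.card) * Real.exp (∑ k, Z k U) ∂(wilsonMeasure (d := 4) (L := 2 * L + 1) r.ρ β) := by
        unfold torusE
        exact integral_mono_of_nonneg (ae_of_all _ fun U => (Real.exp_pos _).le) hintR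
          (ae_of_all _ fun U => hsplit' U)
    _ = Real.exp (A₀ * T.card) * ∫ U, Real.exp (∑ k, Z k U) ∂(wilsonMeasure (d := 4) (L := 2 * L + 1) r.ρ β) :=
        integral_const_mul _ _
    _ ≤ Real.exp (A₀ * T.card) * Real.exp (B' * T.card) :=
        mul_le_mul_of_nonneg_left havg (Real.exp_pos _).le
    _ = Real.exp ((A₀ + B') * T.card) := by rw [← Real.exp_add]; ring_nf

/-- **`MomentBounds6 G r a` from CARRIERS** — `responseMoments_of_carriers` ⊕ p532025 `momentBounds6_of_responseMoments`:
constant `C = C₁ (2 + e^{A₀+B'}) e^{A₀+B'}`, all odd sides, no rate, no reflection positivity, no divisibility.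
[folklore: Georgii (2011) Thm. 4.17 for the DLR part] -/
theorem momentBounds6_of_carriers {K : ℕ} (hK : 0 < K) {C₁ β₁ ℓ₁ A₀ B' P₀ : ℝ} {p : Fin 4 × Fin 4 → ℝ → ℝ}
    (hℓ₁ : 0 < ℓ₁) (hC₁ : 0 < C₁) (hp : ∀ q β, |p q β| ≤ P₀)
    (Y : Fin K → ℝ → ℕ → Fin 4 × Fin 4 → (Fin 4 → ℤ) → LGConfig 4 G → ℝ) (MY : ℝ → ℕ → ℝ)
    (hYm : ∀ k β R q x, Measurable (Y k β R q x)) (hYb : ∀ k β R q x η, |Y k β R q x η| ≤ MY β R)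
    (hsplit : ∀ β : ℝ, β₁ ≤ β → ∀ R : ℕ, 1 ≤ R → (R : ℝ) * a β ≤ ℓ₁ →
      ∀ (q : Fin 4 × Fin 4) (x : Fin 4 → ℤ), q.1 < q.2 → ∀ η : LGConfig 4 G,
        (R : ℝ) ^ 4 / C₁ * |kerE G r β (fun k => x k - (R + 1)) (2 * R + 3) η (plane G r q x) - p q β| ≤
          A₀ + ∑ k, Y k β R q x η)
    (hEM : ∀ k : Fin K, ∀ β : ℝ, β₁ ≤ β → ∀ (L n : ℕ) (q : Fin n → Fin 4 × Fin 4) (x : Fin n → (Fin 4 → ℤ)) (R : ℕ),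
      (∀ i, (q i).1 < (q i).2) → 1 ≤ R → (R : ℝ) * a β ≤ ℓ₁ → 4 * R + 8 ≤ L →
      (∀ i j : Fin n, i ≠ j → ∃ k : Fin 4,
        (2 * (R : ℤ) + 4) ≤ |((((x i k - x j k : ℤ) : ZMod (2 * L + 1))).valMinAbs : ℤ)|) →
      ∀ T : Finset (Fin n),
        torusE G r β L (fun U => Real.exp ((K : ℝ) * ∑ i ∈ T, Y k β R (q i) (x i) U)) ≤ Real.exp (B' * T.card)) :
    MomentBounds6 G r a :=
  momentBounds6_of_responseMoments r a (B := A₀ + B') hℓ₁ hC₁ hp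
    (responseMoments_of_carriers r a hK Y MY hYm hYb hsplit hEM)

/-! ## §2 The two-carrier instance of record: quadratic carrier + large-field carrier from a polymer product law -/

open Summit.QuantumFields.YangMills.Cruxes.UVSeamRec.PolymerRarity
open Summit.QuantumFields.YangMills.Cruxes.UVSeamRec.DefectCollar (integral_prod_indicator_eq_measureReal)

/-- **Large-field carrier: DOUBLED joint exponential moments from the polymer PRODUCT LAW.**  On the odd torus
`(ℤ/(2L+1))⁴` at coupling `β`, let the measurable functional `LF i` of cube `i` be dominated on the torus by a linear
functional of polymer events, `LF i (lift U) ≤ Σ_{γ∈S} c_{iγ} 1_{E_γ}(lift U)` (`c ≥ 0`), with budgets `Σ_i c_{iγ} ≤ Λ`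
(`γ ∈ S`) and `Σ_{γ∈S} c_{iγ} w_γ ≤ W` (all `i`), weights `w_γ ≥ 0`, and the product law
`⟨∏_{γ∈A} 1_{E_γ}∘lift⟩_{2L+1,β} ≤ ∏_{γ∈A} w_γ` for every `A ⊆ S`.  Then for every index set `T`,
`⟨exp(2 Σ_{i∈T} LF i∘lift)⟩_{2L+1,β} ≤ exp(2 e^{2Λ} W · #T)` — p527372 `integral_exp_mul_sum_influence_le` at tilt `λ = 2`,
read on the torus. [folklore; the product-law input is of Bałaban's kind, CMP 122 (1989) (1.79)–(1.89)] -/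
theorem torusE_exp_two_mul_sum_le_of_polymerLaw (β : ℝ) (L : ℕ) {n : ℕ} (LF : Fin n → LGConfig 4 G → ℝ)
    {κ : Type} (S : Finset κ) (E : κ → Set (LGConfig 4 G)) (w : κ → ℝ)
    (c : Fin n → κ → ℝ) {Λ W : ℝ} (hE : ∀ γ, MeasurableSet (E γ)) (hw : ∀ γ ∈ S, 0 ≤ w γ)
    (hc : ∀ i, ∀ γ ∈ S, 0 ≤ c i γ)
    (hdom : ∀ (i : Fin n) (U : GaugeConfig 4 (2 * L + 1) G),
      LF i (torusLift (2 * L + 1) U) ≤ ∑ γ ∈ S, c i γ * (E γ).indicator (fun _ => (1 : ℝ)) (torusLift (2 * L + 1) U))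
    (hΛ : ∀ γ ∈ S, ∑ i, c i γ ≤ Λ) (hW : ∀ i, ∑ γ ∈ S, c i γ * w γ ≤ W)
    (hPL : ∀ A, A ⊆ S → torusE G r β L (fun U => ∏ γ ∈ A, (E γ).indicator (fun _ => (1 : ℝ)) U) ≤ ∏ γ ∈ A, w γ)
    (T : Finset (Fin n)) :
    torusE G r β L (fun U => Real.exp (((2 : ℕ) : ℝ) * ∑ i ∈ T, LF i U)) ≤
      Real.exp (2 * Real.exp (2 * Λ) * W * T.card) := by
  haveI := isProbabilityMeasure_wilsonMeasure (d := 4) (L := 2 * L + 1) r.ρ r.continuous β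
  -- the polymer events read on the torus
  set E' : κ → Set (GaugeConfig 4 (2 * L + 1) G) := fun γ => (torusLift (2 * L + 1)) ⁻¹' (E γ) with hE'def
  have hE' : ∀ γ, MeasurableSet (E' γ) := fun γ => measurable_torusLift _ (hE γ)
  have hpl' : ∀ A, A ⊆ S → (wilsonMeasure (d := 4) (L := 2 * L + 1) r.ρ β).real (⋂ γ ∈ A, E' γ) ≤
      ∏ γ ∈ A, w γ := by
    intro A hA
    rw [← integral_prod_indicator_eq_measureReal _ A E' hE']
    have h1 := hPL A hA
    simp only [torusE] at h1
    simp_rw [hE'def, indicator_one_preimage]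
    exact h1
  have hc' : ∀ i ∈ T, ∀ γ ∈ S, 0 ≤ c i γ := fun i _ γ hγ => hc i γ hγ
  have hΛ' : ∀ γ ∈ S, ∑ i ∈ T, c i γ ≤ Λ := fun γ hγ =>
    (Finset.sum_le_univ_sum_of_nonneg fun i => hc i γ hγ).trans (hΛ γ hγ)
  have hW' : ∀ i ∈ T, ∑ γ ∈ S, c i γ * w γ ≤ W := fun i _ => hW i
  have key := integral_exp_mul_sum_influence_le (wilsonMeasure (d := 4) (L := 2 * L + 1) r.ρ β) T S E' hE' w hw
    c hc' (lam := 2) (by norm_num) hΛ' hW' hpl'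
  -- compare the tilts pointwise: `2·Σ LF ≤ 2·Σ_i Σ_γ c 1_E`
  have hlinm : Measurable fun U : GaugeConfig 4 (2 * L + 1) G =>
      (2 : ℝ) * ∑ i ∈ T, ∑ γ ∈ S, c i γ * (E' γ).indicator (fun _ => (1 : ℝ)) U :=
    (Finset.measurable_sum T fun i _ => Finset.measurable_sum S fun γ _ =>
      (measurable_const.indicator (hE' γ)).const_mul _).const_mul _
  have hχ : ∀ γ (U : GaugeConfig 4 (2 * L + 1) G), |(E' γ).indicator (fun _ => (1 : ℝ)) U| ≤ 1 := fun γ U => by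
    rw [abs_of_nonneg (Set.indicator_nonneg (fun _ _ => zero_le_one) _)]
    exact Set.indicator_apply_le' (fun _ => le_rfl) (fun _ => zero_le_one)
  have hintlin : Integrable (fun U : GaugeConfig 4 (2 * L + 1) G =>
      Real.exp ((2 : ℝ) * ∑ i ∈ T, ∑ γ ∈ S, c i γ * (E' γ).indicator (fun _ => (1 : ℝ)) U))
      (wilsonMeasure (d := 4) (L := 2 * L + 1) r.ρ β) := by
    refine integrable_of_abs_le hlinm.exp (C := Real.exp (2 * ∑ i ∈ T, ∑ γ ∈ S, |c i γ|)) fun U => ?_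
    rw [Real.abs_exp]
    refine Real.exp_le_exp.2 (mul_le_mul_of_nonneg_left ?_ (by norm_num))
    refine Finset.sum_le_sum fun i _ => Finset.sum_le_sum fun γ _ => ?_
    calc c i γ * (E' γ).indicator (fun _ => (1 : ℝ)) U ≤ |c i γ * (E' γ).indicator (fun _ => (1 : ℝ)) U| :=
          le_abs_self _
      _ = |c i γ| * |(E' γ).indicator (fun _ => (1 : ℝ)) U| := abs_mul _ _
      _ ≤ |c i γ| * 1 := mul_le_mul_of_nonneg_left (hχ γ U) (abs_nonneg _)
      _ = |c i γ| := mul_one _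
  have hdom' : ∀ U : GaugeConfig 4 (2 * L + 1) G,
      Real.exp (((2 : ℕ) : ℝ) * ∑ i ∈ T, LF i (torusLift (2 * L + 1) U)) ≤
        Real.exp ((2 : ℝ) * ∑ i ∈ T, ∑ γ ∈ S, c i γ * (E' γ).indicator (fun _ => (1 : ℝ)) U) := fun U => by
    refine Real.exp_le_exp.2 ?_
    rw [Nat.cast_ofNat]
    refine mul_le_mul_of_nonneg_left (Finset.sum_le_sum fun i _ => ?_) (by norm_num)
    have h := hdom i U
    simp only [hE'def, indicator_one_preimage]
    exact h
  calc torusE G r β L (fun U => Real.exp (((2 : ℕ) : ℝ) * ∑ i ∈ T, LF i U))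
      ≤ ∫ U, Real.exp ((2 : ℝ) * ∑ i ∈ T, ∑ γ ∈ S, c i γ * (E' γ).indicator (fun _ => (1 : ℝ)) U)
          ∂(wilsonMeasure (d := 4) (L := 2 * L + 1) r.ρ β) := by
        unfold torusE
        exact integral_mono_of_nonneg (ae_of_all _ fun U => (Real.exp_pos _).le) hintlin
          (ae_of_all _ fun U => hdom' U)
    _ ≤ Real.exp (2 * Real.exp (2 * Λ) * W * T.card) := key

/-- **(RM) from a QUADRATIC carrier with doubled joint exponential moments and a LARGE-FIELD carrier obeying the polymer
product law — the (β) discharge architecture of the v5 stub, abstract in its two carriers.**  Data: measurable carriers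
`Q β R q x` («`βR⁴|F_harm|²`-type») and `LF β R q x` («large-field correction») of the cube exterior, both bounded in
absolute value by `MY β R`; constants `C₁ > 0`, `A₀`, `B_Q`, `Λ`, `W`; reference values `p`.  Hypotheses:
(split) `(R⁴/C₁)|kerE(plane)(η) − p| ≤ A₀ + Q(η) + LF(η)` for EVERY exterior; (EM_Q) `⟨exp(2 Σ_{i∈T} Q_i∘lift)⟩ ≤ e^{B_Q·#T}`
on every odd torus and separated family; (PL) per odd torus and separated family, polymer data `(κ, S, E, w, c)` with
`LF_i∘lift ≤ Σ_γ c_{iγ} 1_{E_γ}∘lift`, `Σ_i c_{iγ} ≤ Λ`, `Σ_γ c_{iγ} w_γ ≤ W` and the product law (p528131's typing with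
CONSTANT budgets).  THEN (RM) VERBATIM with `B = A₀ + max(B_Q, 2e^{2Λ}W)`.  The large-field half is a THEOREM at the
plaquette scale (p530009 `productLaw_largePlaquettes`); the quadratic half is the open Gaussian-domination input.
[folklore; suppliers of Bałaban's kind] -/
theorem responseMoments_of_quadratic_and_polymerLaw {C₁ β₁ ℓ₁ A₀ B_Q Λ W : ℝ} {p : Fin 4 × Fin 4 → ℝ → ℝ}
    (Q LF : ℝ → ℕ → Fin 4 × Fin 4 → (Fin 4 → ℤ) → LGConfig 4 G → ℝ) (MY : ℝ → ℕ → ℝ)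
    (hQm : ∀ β R q x, Measurable (Q β R q x)) (hQb : ∀ β R q x η, |Q β R q x η| ≤ MY β R)
    (hLFm : ∀ β R q x, Measurable (LF β R q x)) (hLFb : ∀ β R q x η, |LF β R q x η| ≤ MY β R)
    (hsplit : ∀ β : ℝ, β₁ ≤ β → ∀ R : ℕ, 1 ≤ R → (R : ℝ) * a β ≤ ℓ₁ →
      ∀ (q : Fin 4 × Fin 4) (x : Fin 4 → ℤ), q.1 < q.2 → ∀ η : LGConfig 4 G,
        (R : ℝ) ^ 4 / C₁ * |kerE G r β (fun k => x k - (R + 1)) (2 * R + 3) η (plane G r q x) - p q β| ≤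
          A₀ + Q β R q x η + LF β R q x η)
    (hEMQ : ∀ β : ℝ, β₁ ≤ β → ∀ (L n : ℕ) (q : Fin n → Fin 4 × Fin 4) (x : Fin n → (Fin 4 → ℤ)) (R : ℕ),
      (∀ i, (q i).1 < (q i).2) → 1 ≤ R → (R : ℝ) * a β ≤ ℓ₁ → 4 * R + 8 ≤ L →
      (∀ i j : Fin n, i ≠ j → ∃ k : Fin 4,
        (2 * (R : ℤ) + 4) ≤ |((((x i k - x j k : ℤ) : ZMod (2 * L + 1))).valMinAbs : ℤ)|) →
      ∀ T : Finset (Fin n),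
        torusE G r β L (fun U => Real.exp (((2 : ℕ) : ℝ) * ∑ i ∈ T, Q β R (q i) (x i) U)) ≤ Real.exp (B_Q * T.card))
    (hPL : ∀ β : ℝ, β₁ ≤ β → ∀ (L n : ℕ) (q : Fin n → Fin 4 × Fin 4) (x : Fin n → (Fin 4 → ℤ)) (R : ℕ),
      (∀ i, (q i).1 < (q i).2) → 1 ≤ R → (R : ℝ) * a β ≤ ℓ₁ → 4 * R + 8 ≤ L →
      (∀ i j : Fin n, i ≠ j → ∃ k : Fin 4,
        (2 * (R : ℤ) + 4) ≤ |((((x i k - x j k : ℤ) : ZMod (2 * L + 1))).valMinAbs : ℤ)|) →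
      ∃ (κ : Type) (S : Finset κ) (E : κ → Set (LGConfig 4 G)) (w : κ → ℝ) (c : Fin n → κ → ℝ),
        (∀ γ, MeasurableSet (E γ)) ∧ (∀ γ ∈ S, 0 ≤ w γ) ∧ (∀ i, ∀ γ ∈ S, 0 ≤ c i γ) ∧
        (∀ (i : Fin n) (U : GaugeConfig 4 (2 * L + 1) G),
          LF β R (q i) (x i) (torusLift (2 * L + 1) U) ≤
            ∑ γ ∈ S, c i γ * (E γ).indicator (fun _ => (1 : ℝ)) (torusLift (2 * L + 1) U)) ∧
        (∀ γ ∈ S, ∑ i, c i γ ≤ Λ) ∧ (∀ i, ∑ γ ∈ S, c i γ * w γ ≤ W) ∧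
        (∀ A, A ⊆ S → torusE G r β L (fun U => ∏ γ ∈ A, (E γ).indicator (fun _ => (1 : ℝ)) U) ≤
          ∏ γ ∈ A, w γ)) :
    ∀ β : ℝ, β₁ ≤ β → ∀ (L n : ℕ) (q : Fin n → Fin 4 × Fin 4) (x : Fin n → (Fin 4 → ℤ)) (R : ℕ),
      (∀ i, (q i).1 < (q i).2) → 1 ≤ R → (R : ℝ) * a β ≤ ℓ₁ → 4 * R + 8 ≤ L →
      (∀ i j : Fin n, i ≠ j → ∃ k : Fin 4,
        (2 * (R : ℤ) + 4) ≤ |((((x i k - x j k : ℤ) : ZMod (2 * L + 1))).valMinAbs : ℤ)|) →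
      ∀ T : Finset (Fin n),
        torusE G r β L (fun U => Real.exp (∑ i ∈ T, (R : ℝ) ^ 4 / C₁ *
          |kerE G r β (fun k => x i k - (R + 1)) (2 * R + 3) U (plane G r (q i) (x i)) - p (q i) β|)) ≤
          Real.exp ((A₀ + max B_Q (2 * Real.exp (2 * Λ) * W)) * T.card) := by
  -- the two carriers as a `Fin 2`-family
  set Y : Fin 2 → ℝ → ℕ → Fin 4 × Fin 4 → (Fin 4 → ℤ) → LGConfig 4 G → ℝ := ![Q, LF] with hYdef
  refine responseMoments_of_carriers r a (K := 2) (by norm_num) Y MY ?_ ?_ ?_ ?_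
  · intro k β R q x
    fin_cases k
    · simpa [hYdef] using hQm β R q x
    · simpa [hYdef] using hLFm β R q x
  · intro k β R q x η
    fin_cases k
    · simpa [hYdef] using hQb β R q x η
    · simpa [hYdef] using hLFb β R q x η
  · intro β hβ R hR hRa q x hq η
    have h := hsplit β hβ R hR hRa q x hq η
    simpa [hYdef, Fin.sum_univ_two, add_assoc] using h
  · intro k β hβ L n q x R hq hR hRa hRL hsep T
    fin_cases k
    · -- the quadratic carrier
      have h := hEMQ β hβ L n q x R hq hR hRa hRL hsep T
      refine (le_of_eq ?_).trans (h.trans (Real.exp_le_exp.2 ?_))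
      · simp [hYdef]
      · exact mul_le_mul_of_nonneg_right (le_max_left _ _) (Nat.cast_nonneg _)
    · -- the large-field carrier, from the product law
      obtain ⟨κ, S, E, w, c, hE, hw, hc, hdom, hΛ, hW, hpl⟩ := hPL β hβ L n q x R hq hR hRa hRL hsep
      have h := torusE_exp_two_mul_sum_le_of_polymerLaw r β L (fun i => LF β R (q i) (x i))
        S E w c hE hw hc hdom hΛ hW hpl T
      refine (le_of_eq ?_).trans (h.trans (Real.exp_le_exp.2 ?_))
      · simp [hYdef]
      · exact mul_le_mul_of_nonneg_right (le_max_right _ _) (Nat.cast_nonneg _)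

end Route

end Summit.QuantumFields.YangMills.Cruxes.UVSeamRec.TemperedResponse

end
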